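import Summits.QuantumFields.YangMills.Theorems.BalabanLadderNTMirrorHankel
import Summits.QuantumFields.YangMills.Theorems.PencilRigidityCurvatureKernelBoundLogConvexExpDecay
import HarnessLib

/-!
# Crux `NT` (stmt-QuantumFields-19353): a mirror floor PROPAGATES outward — and caps any clustering rate

Helper file (`--supports stmt-QuantumFields-19353`) of the fleet lead prover of crux `NT` (unit `ym-spine-19353-p1`,
g10), hypothesis-free; sequel of `…NTMirrorHankelShift` / `…NTMirrorHankel`, which prove that on every odd torus
`(ℤ/(2S+1)ℤ)^d` (every compact `G`, continuous unitary `ρ`, `β ≥ 0`) the mirror sequence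
`q(n) = Cov_T(F∘ϑ, F_n)` of a bounded real observable `F` of the slab `0 ≤ t ≤ T` is NON-NEGATIVE and LOG-CONVEX in
the time separation `n` while the translate stays in the non-negative half (`2T + n ≤ 2S`).  Here the consequences:

* §1 (pure real analysis, on top of the tree's discrete chord lemma `CurvatureKernel.LogConvex.le_chord`, p-landed by
  the `CurvatureKernelBound` line): `pow_le_pow_mul_pow_of_logConvex` — a non-negative sequence that is log-convex on the
  interior of `[0, U]` satisfies the cleared-denominator THREE-POINT inequality `E u ^ U ≤ E 0 ^ (U − u) · E U ^ u`
  (`u ≤ U`; no logarithm, no real power, zeros allowed); `floor_pow_le_of_logConvex` — hence a FLOOR `X ≤ E u` and a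
  CEILING `E 0 ≤ Y` propagate the floor outward: `X ^ U ≤ Y ^ (U − u) · E U ^ u`.
* §2 (the mirror sequence): `mirrorSeq_zero_le_sq` (the trivial ceiling `q(0) ≤ K²` for `|F| ≤ K`),
  `mirrorSeq_pow_le` (three-point inequality for `q`), **`mirrorSeq_floor_propagates`**: a floor `X ≤ q(u)` at ONE
  separation `u` forces `X ^ U ≤ (K²) ^ (U − u) · q(U) ^ u` at EVERY larger separation `U` with `2T + U ≤ 2S` — the
  floor decays at most geometrically, with ratio `(X/K²)^{1/u}` per lattice unit;
* §3 (the cap): **`mul_le_log_of_floor_of_decay`** — if moreover `q(U) ≤ C·exp(−μ U)` at such a `U` (`C > 0`), then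
  `μ · u ≤ log (K²/X) + (u/U) · log (C/K²)`.  Reading for the crux (no registry content): the seam's (MF) floor
  `X ≤ Cov_T(Ṽ_v∘Θ₀, Ṽ_v)`, for `v` supported at physical times `≥ δ`, is `X ≤ q(u)` with `u = 2δ/a(β)` for the smearing
  moved down to the mirror; `K = sup |Ṽ_v| ≍ ‖v‖₁ a(β)⁻⁴`; so a β-UNIFORM floor is compatible with exponential clustering
  of the mirror correlator at lattice rate `μ` only if `μ · 2δ/a ≤ log(K²/X) + o(1)`, i.e. the mass in the unit `a(β)`
  obeys `m_phys = μ/a ≤ (8 log(1/a(β)) + log(C_v/X))/(2δ)`: «in finer units the floors die by clustering», quantified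
  — the floor currency tolerates a physical mass growing at most like `log(1/a(β)) ≍ β`, and a lattice mass `μ(β)` kills
  every floor at separations `u > log(K²/X)/μ(β)`.

Refs: J. Glimm, A. Jaffe, *Quantum Physics* (1987) §6.1 and E. Seiler, LNP 159 (1982) Ch. 2 (spectral/transfer-matrix
origin of log-convexity); the discrete chord lemma is the tree's (`PencilRigidityCurvatureKernelBoundLogConvexExpDecay`);
sibling statements in other currencies: `FiniteSusceptibilityWeakCoupling.MirrorLogConvex` (species /
`latticeConnectedCorr` letters, `d = 4`), `SoloBlind…OddTorusLogConvex` (slice observables).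
-/

set_option autoImplicit false

noncomputable section

open MeasureTheory Finset
open Literature.MathematicalPhysics.QuantumFieldTheory
open Literature.MathematicalPhysics.QuantumFieldTheory.WilsonRP
open Literature.MathematicalPhysics.QuantumFieldTheory.WilsonOddRP
open Literature.MathematicalPhysics.QuantumFieldTheory.WilsonSiteRP
open Literature.MathematicalPhysics.QuantumFieldTheory.WilsonNegRP
open Summit.QuantumFields.YangMills.Theorems.CurvatureKernel.LogConvex (le_chord all_pos two_mul_log_le)

namespace Summit.QuantumFields.YangMills.Cruxes.NT.MirrorHankel

/-! ## §1 Real analysis: the three-point inequality and floor propagation for log-convex sequences -/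

section Real

/-- **Three-point inequality, cleared denominators.**  A sequence that is non-negative on `[0, U]` and log-convex at
the interior points (`E v ^ 2 ≤ E (v−1) · E (v+1)` for `0 < v < U`) satisfies `E u ^ U ≤ E 0 ^ (U − u) · E U ^ u` for
every `u ≤ U` (if `E u = 0` this is trivial; otherwise every term is positive, `CurvatureKernel.LogConvex.all_pos`, and
it is the exponential of the chord inequality `U (log E u − log E 0) ≤ u (log E U − log E 0)` of
`CurvatureKernel.LogConvex.le_chord`). [folklore] -/
theorem pow_le_pow_mul_pow_of_logConvex (E : ℕ → ℝ) (U : ℕ) (hnn : ∀ v, v ≤ U → 0 ≤ E v)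
    (hlc : ∀ v, 0 < v → v < U → E v ^ 2 ≤ E (v - 1) * E (v + 1)) {u : ℕ} (hu : u ≤ U) :
    E u ^ U ≤ E 0 ^ (U - u) * E U ^ u := by
  rcases Nat.eq_zero_or_pos u with rfl | hu0
  · simp
  rcases hu.eq_or_lt with rfl | huU
  · simp
  rcases (hnn u hu).eq_or_lt with h0 | hpos
  · rw [← h0, zero_pow (by omega)]
    exact mul_nonneg (pow_nonneg (hnn 0 (Nat.zero_le _)) _) (pow_nonneg (hnn U le_rfl) _)
  have hall := all_pos E U hnn hlc u hu0 huU hpos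
  have hE0 := hall 0 (Nat.zero_le _)
  have hEU := hall U le_rfl
  have key := le_chord (fun v => Real.log (E v)) U
    (fun v hv0 hvU => two_mul_log_le E v (hall _ (by omega)) (hall _ hvU.le) (hall _ (by omega)) (hlc v hv0 hvU))
    u hu
  rw [← Real.log_le_log_iff (pow_pos hpos _) (mul_pos (pow_pos hE0 _) (pow_pos hEU _)), Real.log_mul
    (pow_pos hE0 _).ne' (pow_pos hEU _).ne', Real.log_pow, Real.log_pow, Real.log_pow, Nat.cast_sub hu]
  linarith

/-- **A floor propagates outward through a log-convex sequence.**  With `E` as above, a floor `X ≤ E u` (`0 ≤ X`) at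
some `u ≤ U` and a ceiling `E 0 ≤ Y` at the origin give `X ^ U ≤ Y ^ (U − u) · E U ^ u`: the value at the far point
`U` is at least `X · (X/Y)^{(U−u)/u}`. [folklore] -/
theorem floor_pow_le_of_logConvex (E : ℕ → ℝ) (U : ℕ) (hnn : ∀ v, v ≤ U → 0 ≤ E v)
    (hlc : ∀ v, 0 < v → v < U → E v ^ 2 ≤ E (v - 1) * E (v + 1)) {u : ℕ} (hu : u ≤ U) {X Y : ℝ} (hX : 0 ≤ X)
    (hfloor : X ≤ E u) (hceil : E 0 ≤ Y) :
    X ^ U ≤ Y ^ (U - u) * E U ^ u := by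
  have h := pow_le_pow_mul_pow_of_logConvex E U hnn hlc hu
  calc X ^ U ≤ E u ^ U := pow_le_pow_left₀ hX hfloor U
    _ ≤ E 0 ^ (U - u) * E U ^ u := h
    _ ≤ Y ^ (U - u) * E U ^ u :=
        mul_le_mul_of_nonneg_right (pow_le_pow_left₀ (hnn 0 (Nat.zero_le _)) hceil _) (pow_nonneg (hnn U le_rfl) _)

/-- **The cap a floor puts on a geometric decay rate.**  If `0 < X ≤ E u` (`u ≤ U`), `E 0 ≤ Y` with `0 < Y`, and at the
far point `E U ≤ C · exp (−μ U)` with `C > 0`, then `μ · u · U ≤ U · log (Y/X) + u · log (C/Y)`, i.e.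
`μ u ≤ log (Y/X) + (u/U) log (C/Y)`. [folklore] -/
theorem mul_mul_le_of_floor_of_decay (E : ℕ → ℝ) (U : ℕ) (hnn : ∀ v, v ≤ U → 0 ≤ E v)
    (hlc : ∀ v, 0 < v → v < U → E v ^ 2 ≤ E (v - 1) * E (v + 1)) {u : ℕ} (hu : u ≤ U) {X Y C μ : ℝ}
    (hX : 0 < X) (hfloor : X ≤ E u) (hY : 0 < Y) (hceil : E 0 ≤ Y) (hC : 0 < C)
    (hdecay : E U ≤ C * Real.exp (-(μ * U))) :
    μ * u * U ≤ U * Real.log (Y / X) + u * Real.log (C / Y) := by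
  have h1 := floor_pow_le_of_logConvex E U hnn hlc hu hX.le hfloor hceil
  have h2 : E U ^ u ≤ (C * Real.exp (-(μ * U))) ^ u := pow_le_pow_left₀ (hnn U le_rfl) hdecay u
  have h3 : X ^ U ≤ Y ^ (U - u) * (C * Real.exp (-(μ * U))) ^ u :=
    h1.trans (mul_le_mul_of_nonneg_left h2 (pow_nonneg hY.le _))
  have hCe : 0 < C * Real.exp (-(μ * U)) := mul_pos hC (Real.exp_pos _)
  have h4 := Real.log_le_log (pow_pos hX _) h3
  rw [Real.log_mul (pow_pos hY _).ne' (pow_pos hCe _).ne', Real.log_pow, Real.log_pow, Real.log_pow,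
    Real.log_mul hC.ne' (Real.exp_pos _).ne', Real.log_exp, Nat.cast_sub hu] at h4
  rw [Real.log_div hY.ne' hX.ne', Real.log_div hC.ne' hY.ne']
  nlinarith [h4]

end Real

/-! ## §2 The mirror sequence: trivial ceiling at the origin, three-point inequality, floor propagation -/

section Torus

variable {d L N : ℕ} [NeZero d] [NeZero L]
variable {G : Type*} [Group G] [TopologicalSpace G] [IsTopologicalGroup G] [CompactSpace G]
  [MeasurableSpace G] [BorelSpace G] (ρ : G →* Matrix (Fin N) (Fin N) ℂ)

/-- **The trivial ceiling at the origin**: `q(0) = ∫ (F∘ϑ)·F − (∫F)² ≤ K²` for `|F| ≤ K`. [folklore] -/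
theorem mirrorSeq_zero_le_sq (hρ : Continuous ρ) (β : ℝ) {F : GaugeConfig d L G → ℝ} (hFm : Measurable F) {K : ℝ}
    (hK : ∀ U, |F U| ≤ K) : mirrorSeq ρ β F 0 ≤ K ^ 2 := by
  haveI := isProbabilityMeasure_wilsonMeasure (d := d) (L := L) ρ hρ β
  rw [mirrorSeq_eq, timeShift_zero]
  have hϑm : Measurable (GaugeConfig.negReflect : GaugeConfig d L G → GaugeConfig d L G) := measurable_negReflect
  have hbd : ∀ U : GaugeConfig d L G, F U.negReflect * F U ≤ K ^ 2 := fun U => by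
    have h := abs_mul (F U.negReflect) (F U) ▸ (mul_le_mul (hK U.negReflect) (hK U) (abs_nonneg _)
      ((abs_nonneg _).trans (hK U.negReflect)))
    rw [sq]
    exact (le_abs_self _).trans h
  have hint : Integrable (fun U => F U.negReflect * F U) (wilsonMeasure ρ β) :=
    Reflection.integrable_wilson_of_bdd ρ hρ β ((hFm.comp hϑm).mul hFm)
      ⟨K * K, fun U => by
        rw [abs_mul]
        exact mul_le_mul (hK U.negReflect) (hK U) (abs_nonneg _) ((abs_nonneg _).trans (hK U.negReflect))⟩
  have h1 : ∫ U, F U.negReflect * F U ∂(wilsonMeasure ρ β) ≤ ∫ _U, K ^ 2 ∂(wilsonMeasure ρ β) :=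
    integral_mono hint (integrable_const _) hbd
  rw [integral_const, smul_eq_mul, probReal_univ, one_mul] at h1
  nlinarith [sq_nonneg (∫ U, F U ∂(wilsonMeasure ρ β))]

/-- **Three-point inequality for the mirror sequence** (side `2S+1`, `S ≥ 1`, `β ≥ 0`, `F` a bounded measurable real
observable of the slab `0 ≤ t ≤ T`): `q(u) ^ U ≤ q(0) ^ (U − u) · q(U) ^ u` for `u ≤ U` and `2T + U ≤ 2S`.
[cite: GlimmJaffe1987, §6.1] -/
theorem mirrorSeq_pow_le {S : ℕ} (hL : L = 2 * S + 1) (hS : 1 ≤ S) (hρ : Continuous ρ) {β : ℝ} (hβ : 0 ≤ β)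
    {F : GaugeConfig d L G → ℝ} (hFm : Measurable F) (hFb : ∃ K : ℝ, ∀ U, |F U| ≤ K) {T : ℕ}
    (hFdep : DependsOn F (slab (d := d) (L := L) 0 T)) {u U : ℕ} (hu : u ≤ U) (hU : 2 * T + U ≤ 2 * S) :
    mirrorSeq ρ β F u ^ U ≤ mirrorSeq ρ β F 0 ^ (U - u) * mirrorSeq ρ β F U ^ u :=
  pow_le_pow_mul_pow_of_logConvex (mirrorSeq ρ β F) U
    (fun v hv => mirrorSeq_nonneg ρ hL hS hρ hβ hFm hFb hFdep (by omega))
    (fun v hv0 hvU => by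
      have h := mirrorSeq_logConvex ρ hL hS hρ hβ hFm hFb hFdep (n := v - 1) (by omega)
      rwa [show v - 1 + 1 = v by omega, show v - 1 + 2 = v + 1 by omega] at h)
    hu

/-- **A mirror floor propagates outward.**  If `X ≤ q(u)` (`0 ≤ X`) at one separation `u ≤ U` with `2T + U ≤ 2S`, and
`|F| ≤ K`, then `X ^ U ≤ (K²) ^ (U − u) · q(U) ^ u`: the mirror floor at separation `U` is at least
`X · (X/K²)^{(U−u)/u}`. [cite: GlimmJaffe1987, §6.1] -/
theorem mirrorSeq_floor_propagates {S : ℕ} (hL : L = 2 * S + 1) (hS : 1 ≤ S) (hρ : Continuous ρ) {β : ℝ}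
    (hβ : 0 ≤ β) {F : GaugeConfig d L G → ℝ} (hFm : Measurable F) {K : ℝ} (hK : ∀ U, |F U| ≤ K) {T : ℕ}
    (hFdep : DependsOn F (slab (d := d) (L := L) 0 T)) {u U : ℕ} (hu : u ≤ U) (hU : 2 * T + U ≤ 2 * S) {X : ℝ}
    (hX : 0 ≤ X) (hfloor : X ≤ mirrorSeq ρ β F u) :
    X ^ U ≤ (K ^ 2) ^ (U - u) * mirrorSeq ρ β F U ^ u :=
  floor_pow_le_of_logConvex (mirrorSeq ρ β F) U
    (fun v hv => mirrorSeq_nonneg ρ hL hS hρ hβ hFm ⟨K, hK⟩ hFdep (by omega))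
    (fun v hv0 hvU => by
      have h := mirrorSeq_logConvex ρ hL hS hρ hβ hFm ⟨K, hK⟩ hFdep (n := v - 1) (by omega)
      rwa [show v - 1 + 1 = v by omega, show v - 1 + 2 = v + 1 by omega] at h)
    hu hX hfloor (mirrorSeq_zero_le_sq ρ hρ β hFm hK)

/-! ## §3 The cap a mirror floor puts on a clustering rate -/

/-- **A mirror floor caps any clustering rate.**  If `0 < X ≤ q(u)` at one separation `u ≤ U` (`2T + U ≤ 2S`,
`|F| ≤ K`, `0 < K`) and the mirror correlator CLUSTERS at the far separation, `q(U) ≤ C · exp(−μ U)` (`C > 0`), then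
`μ · u · U ≤ U · log (K²/X) + u · log (C/K²)`, i.e. `μ · u ≤ log (K²/X) + (u/U) · log (C/K²)`: uniformly in the torus,
a floor of size `X` at separation `u` tolerates a lattice mass `μ ≲ log(K²/X)/u` only. [cite: GlimmJaffe1987, §6.1] -/
theorem mul_mul_le_log_of_mirrorFloor_of_decay {S : ℕ} (hL : L = 2 * S + 1) (hS : 1 ≤ S) (hρ : Continuous ρ)
    {β : ℝ} (hβ : 0 ≤ β) {F : GaugeConfig d L G → ℝ} (hFm : Measurable F) {K : ℝ} (hKpos : 0 < K)
    (hK : ∀ U, |F U| ≤ K) {T : ℕ} (hFdep : DependsOn F (slab (d := d) (L := L) 0 T)) {u U : ℕ} (hu : u ≤ U)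
    (hU : 2 * T + U ≤ 2 * S) {X C μ : ℝ} (hX : 0 < X) (hfloor : X ≤ mirrorSeq ρ β F u) (hC : 0 < C)
    (hdecay : mirrorSeq ρ β F U ≤ C * Real.exp (-(μ * U))) :
    μ * u * U ≤ U * Real.log (K ^ 2 / X) + u * Real.log (C / K ^ 2) :=
  mul_mul_le_of_floor_of_decay (mirrorSeq ρ β F) U
    (fun v hv => mirrorSeq_nonneg ρ hL hS hρ hβ hFm ⟨K, hK⟩ hFdep (by omega))
    (fun v hv0 hvU => by
      have h := mirrorSeq_logConvex ρ hL hS hρ hβ hFm ⟨K, hK⟩ hFdep (n := v - 1) (by omega)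
      rwa [show v - 1 + 1 = v by omega, show v - 1 + 2 = v + 1 by omega] at h)
    hu hX hfloor (pow_pos hKpos 2) (mirrorSeq_zero_le_sq ρ hρ β hFm hK) hC hdecay

end Torus

end Summit.QuantumFields.YangMills.Cruxes.NT.MirrorHankel

end
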